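import Literature.Barriers.NavierStokesRegularity.AxisymmetricTypeIExclusionHolds
import Summits.NavierStokesRegularity.NavierStokesRegularity.Theorems.SqueezeCycleRecurrentLiouvilleAxisymRegular
import Literature.Analysis.FluidPDE.LocalTypeI
import Literature.Analysis.FluidPDE.ClassicalSuitable
import Literature.Analysis.FluidPDE.PineauVicolOneSliceGradient
import HarnessLib

/-!
# Crux `FrequencyRigidity` (stmt-NavierStokesRegularity-2955), line `scaled-energy-split`:
# the axisymmetric unit-viscosity core

Helper file (`--supports stmt-NavierStokesRegularity-2955`; theorems only, sorry-free).  Stub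
`stub_axisymmetricFlatCore_unit`, the `ν = 1` axisymmetric case of Stub 2 of the line: let
`(u, p)` be a classical solution of the unforced Navier–Stokes system with unit viscosity on
`(−∞, 0) × ℝ³` with the Type I rate `‖u(t, x)‖ ≤ C/√(−t)`, axisymmetric slices, and
finite Albritton–Barker quantity `𝐈 = 𝐈(ℝ³ × ℝ₋) < ∞` (`typeIBound (Iio 0 ×ˢ univ)`, the
supremum of `A + C + D + E` over all backward parabolic balls of the lower half space).  Then
the space–time origin is NOT a backward singular point of `u` (`¬ IsBackwardSingularPoint u 0`).

Proof.  The Seregin–Šverák unit cylinder `Q = 𝒞 × ]−1, 0[` lies in the parabolic ball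
`Q((0,0), 2)` of the lower half space, so the `C`- and `D`-terms of `𝐈` at that ball give
`u ∈ L³(Q)` and `p − [p]_{0,2}(t) ∈ L^{3/2}(Q)`.  The classical solution is distributional on
`Q` (`isDistributionalNSSolutionOn_of_contDiffOn`), and the pressure gauged by its ball mean
`[p]_{0,2}(t)` — continuous in `t < 0` by dominated convergence — is still a distributional
pressure (`IsDistributionalNSSolutionOn.sub_timeFun`); the Type I rate gives
`√(−t)‖u‖ ≤ C` on `Q`.  Seregin–Šverák 2009, Thm. 3.1 (the tree theorem
`axisymmetricTypeIExclusion_of_tree`) then makes `u` essentially bounded on some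
`Q((0,0), r)`, contradicting backward singularity of the origin.

## References

* G. Seregin, V. Šverák, *On Type I singularities of the local axi-symmetric solutions of the
  Navier–Stokes equations*, Comm. PDE 34 (2009), 171–201, Thm. 3.1 (= Thm. 1.1).
  [SereginSverak2009]
* D. Albritton, T. Barker, *On local Type I singularities of the Navier–Stokes equations and
  Liouville theorems*, J. Math. Fluid Mech. 21 (2019), §1 (the quantities `A, C, D, E, 𝐈(ω)`
  and backward singular points). [AlbrittonBarker2019]
-/

noncomputable section

-- the registered stub namespace repeats the summit name `NavierStokesRegularity` (summit = problem)
set_option linter.dupNamespace false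

namespace Summit.NavierStokesRegularity.NavierStokesRegularity.Theorems.FrequencyRigidity.ScaledEnergySplit

open Literature.Analysis.FluidPDE Literature.Barriers.NavierStokesRegularity MeasureTheory Set
  Filter Topology Function Metric
open scoped ENNReal NNReal

/-! ## Geometry: the Seregin–Šverák cylinder inside the parabolic ball `Q((0,0), 2)`
(`rlAxisymRegular_ssCylinder_subset`, landed with the crux `RecurrentLiouville`) -/

/-- The parabolic ball `Q((0,0), 2)` lies in the lower half space `ℝ₋ × ℝ³`. [folklore] -/
theorem parabolicCylinder_two_subset_lowerHalf :
    parabolicCylinder 2 (0 : ℝ × EuclideanSpace ℝ (Fin 3)) ⊆ Iio (0 : ℝ) ×ˢ univ :=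
  fun w hw => ⟨by simpa using (mem_parabolicCylinder.1 hw).1.2, mem_univ _⟩

/-- The unit cylinder lies in the slab `(−∞, 0) × ℝ³`. [folklore] -/
theorem ssCylinder_subset_lowerHalf :
    ((ssCylinderOpens : TopologicalSpace.Opens (ℝ × EuclideanSpace ℝ (Fin 3))) :
        Set (ℝ × EuclideanSpace ℝ (Fin 3))) ⊆ Iio (0 : ℝ) ×ˢ univ :=
  rlAxisymRegular_ssCylinder_subset.trans parabolicCylinder_two_subset_lowerHalf

/-! ## The `C`- and `D`-terms of `𝐈` on the unit cylinder -/

variable {u : ℝ → EuclideanSpace ℝ (Fin 3) → EuclideanSpace ℝ (Fin 3)}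
  {p : ℝ → EuclideanSpace ℝ (Fin 3) → ℝ}

/-- Finite `𝐈(ℝ³ × ℝ₋)` bounds `(A + C + D + E)(Q((0,0), 2))`, an admissible ball.
[cite: AlbrittonBarker2019, §1 (display defining 𝐈(ω) after Thm 1.1)] -/
theorem abScaledSum_two_lt_top
    {G : ℝ → EuclideanSpace ℝ (Fin 3) → EuclideanSpace ℝ (Fin 3) →L[ℝ] EuclideanSpace ℝ (Fin 3)}
    (hI : typeIBound (Iio (0 : ℝ) ×ˢ univ) u p G < ⊤) :
    abScaledSum 2 (0 : ℝ × EuclideanSpace ℝ (Fin 3)) u p G < ⊤ :=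
  (abScaledSum_le_typeIBound two_pos parabolicCylinder_two_subset_lowerHalf).trans_lt hI

/-- The normalising factor `(r²)⁻¹ = 1/4` of the `C`- and `D`-terms at radius `2` is nonzero.
[folklore] -/
theorem inv_ofReal_two_sq_ne_zero : (ENNReal.ofReal 2 ^ 2)⁻¹ ≠ 0 :=
  ENNReal.inv_ne_zero.2 (ENNReal.pow_ne_top ENNReal.ofReal_ne_top)

/-- From `C(Q((0,0),2)) < ∞`: `u ∈ L³` of the unit cylinder. [folklore] -/
theorem lintegral_cube_ssCylinder_lt_top
    (hC : cknC 2 (0 : ℝ × EuclideanSpace ℝ (Fin 3)) u < ⊤) :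
    ∫⁻ z in ssCylinder, ‖u z.1 z.2‖ₑ ^ (3 : ℕ) < ∞ :=
  (lintegral_mono_set rlAxisymRegular_ssCylinder_subset).trans_lt
    (ENNReal.lt_top_of_mul_ne_top_right hC.ne inv_ofReal_two_sq_ne_zero)

/-- From `D(Q((0,0),2)) < ∞` (mean-free pressure term): the pressure gauged by its mean over the
ball `B(0, 2)` is in `L^{3/2}` of the unit cylinder. [folklore] -/
theorem lintegral_gaugedPressure_ssCylinder_lt_top
    (hD : cknDOsc 2 (0 : ℝ × EuclideanSpace ℝ (Fin 3)) p < ⊤) :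
    ∫⁻ z in ssCylinder,
      ‖p z.1 z.2 - ⨍ y in ball (0 : EuclideanSpace ℝ (Fin 3)) 2, p z.1 y‖ₑ ^ (3 / 2 : ℝ) < ∞ := by
  have h := ENNReal.lt_top_of_mul_ne_top_right hD.ne inv_ofReal_two_sq_ne_zero
  rw [Prod.snd_zero] at h
  exact (lintegral_mono_set rlAxisymRegular_ssCylinder_subset).trans_lt h

/-! ## The pressure gauge: continuity of the ball mean -/

/-- **Continuity of the ball integral of the pressure.** If `p` is jointly continuous on
`(−∞, 0) × ℝ³`, then `t ↦ ∫_{B(0,R)} p(t, y) dy` is continuous on `(−∞, 0)` (dominated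
convergence on a compact time window, `p` being bounded on `window × closedBall`). [folklore] -/
theorem continuousOn_setIntegral_ball (hp : ContinuousOn (uncurry p) (Iio (0 : ℝ) ×ˢ univ))
    (R : ℝ) :
    ContinuousOn (fun t => ∫ y in ball (0 : EuclideanSpace ℝ (Fin 3)) R, p t y) (Iio 0) := by
  intro t₀ ht₀
  have ht₀' : t₀ < 0 := ht₀
  have hW : Icc (t₀ - 1) (t₀ / 2) ∈ 𝓝 t₀ := Icc_mem_nhds (by linarith) (by linarith)
  have hWS : Icc (t₀ - 1) (t₀ / 2) ⊆ Iio (0 : ℝ) := fun t ht =>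
    lt_of_le_of_lt ht.2 (by linarith)
  obtain ⟨M, hM⟩ :=
    (isCompact_Icc.prod (isCompact_closedBall (0 : EuclideanSpace ℝ (Fin 3)) R))
      |>.exists_bound_of_continuousOn (hp.mono (prod_mono hWS (subset_univ _)))
  have hslice : ∀ t ∈ Iio (0 : ℝ), Continuous (p t) := fun t ht =>
    hp.comp_continuous (continuous_const.prodMk continuous_id) fun y => ⟨ht, mem_univ y⟩
  refine (continuousAt_of_dominated
    (μ := volume.restrict (ball (0 : EuclideanSpace ℝ (Fin 3)) R))
    (bound := fun _ => M) ?_ ?_ ?_ ?_).continuousWithinAt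
  · filter_upwards [hW] with t ht
    exact (hslice t (hWS ht)).aestronglyMeasurable
  · filter_upwards [hW] with t ht
    filter_upwards [ae_restrict_mem measurableSet_ball] with y hy
    exact hM (t, y) (mk_mem_prod ht (ball_subset_closedBall hy))
  · exact integrableOn_const measure_ball_lt_top.ne
  · filter_upwards with y
    have h1 : ContinuousAt (uncurry p) (t₀, y) :=
      hp.continuousAt ((isOpen_Iio.prod isOpen_univ).mem_nhds (mk_mem_prod ht₀ (mem_univ y)))
    exact ContinuousAt.comp_of_eq h1 (continuousAt_id.prodMk continuousAt_const) rfl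

/-- Hence the ball mean `t ↦ ⨍_{B(0,R)} p(t, y) dy` is continuous on `(−∞, 0)`.
[folklore] -/
theorem continuousOn_ballAverage (hp : ContinuousOn (uncurry p) (Iio (0 : ℝ) ×ˢ univ))
    (R : ℝ) :
    ContinuousOn (fun t => ⨍ y in ball (0 : EuclideanSpace ℝ (Fin 3)) R, p t y) (Iio 0) := by
  have h := (continuousOn_setIntegral_ball hp R).const_smul
    ((volume : Measure (EuclideanSpace ℝ (Fin 3))).real
      (ball (0 : EuclideanSpace ℝ (Fin 3)) R))⁻¹
  refine h.congr fun t _ => ?_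
  exact setAverage_eq _ _ _

/-- The gauge `(t, x) ↦ ⨍_{B(0,R)} p(t, y) dy` is locally integrable on the unit cylinder
(continuous on the open set `Q ⊆ (−∞,0) × ℝ³`). [folklore] -/
theorem locallyIntegrableOn_ballAverage (hp : ContinuousOn (uncurry p) (Iio (0 : ℝ) ×ˢ univ))
    (R : ℝ) :
    LocallyIntegrableOn
      (fun z : ℝ × EuclideanSpace ℝ (Fin 3) =>
        ⨍ y in ball (0 : EuclideanSpace ℝ (Fin 3)) R, p z.1 y)
      ssCylinder volume := by
  refine ContinuousOn.locallyIntegrableOn ?_ isOpen_ssCylinder.measurableSet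
  exact (continuousOn_ballAverage hp R).comp continuous_fst.continuousOn
    fun z hz => (mem_ssCylinder.1 hz).1.2

/-! ## Classical solutions on `(−∞, 0)` are distributional on the unit cylinder -/

/-- A classical solution of the unforced unit-viscosity system on the open time set `(−∞, 0)` is
a distributional solution on the unit cylinder (`isDistributionalNSSolutionOn_of_contDiffOn`;
Caffarelli–Kohn–Nirenberg 1982, (2.2)). [folklore] -/
theorem isDistributionalNSSolutionOn_ssCylinder_of_classical
    (h : IsClassicalNSSolutionOn (Iio (0 : ℝ)) 1 0 u p) :
    IsDistributionalNSSolutionOn ssCylinderOpens 1 0 u p := by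
  have hu2 : ContDiffOn ℝ 2 (uncurry u) (Iio (0 : ℝ) ×ˢ univ) :=
    h.smooth_velocity.of_le (by norm_cast)
  have hp1 : ContDiffOn ℝ 1 (uncurry p) (Iio (0 : ℝ) ×ˢ univ) :=
    h.smooth_pressure.of_le (by norm_cast)
  have hf : ContinuousOn
      (uncurry (0 : ℝ → EuclideanSpace ℝ (Fin 3) → EuclideanSpace ℝ (Fin 3)))
      (Iio (0 : ℝ) ×ˢ univ) :=
    continuousOn_const
  refine isDistributionalNSSolutionOn_of_contDiffOn isOpen_Iio ssCylinder_subset_lowerHalf hu2 hp1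
    hf (fun t ht x => ?_) h.divFree
  have hm := h.momentum t ht x
  rwa [timeDerivWithin_eq_deriv isOpen_Iio ht, ← timeDeriv_apply] at hm

/-- The same with the pressure gauged by its ball mean `[p]_{0,R}(t)` (the pressure of a
distributional solution is determined up to a locally integrable function of time,
`IsDistributionalNSSolutionOn.sub_timeFun`). [folklore] -/
theorem isDistributionalNSSolutionOn_ssCylinder_gauged
    (h : IsClassicalNSSolutionOn (Iio (0 : ℝ)) 1 0 u p) (R : ℝ) :
    IsDistributionalNSSolutionOn ssCylinderOpens 1 0 u
      (fun t x => p t x - ⨍ y in ball (0 : EuclideanSpace ℝ (Fin 3)) R, p t y) :=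
  (isDistributionalNSSolutionOn_ssCylinder_of_classical h).sub_timeFun
    (locallyIntegrableOn_ballAverage h.smooth_pressure.continuousOn R)

/-! ## The Type I rate on the unit cylinder -/

/-- The pointwise Type I rate `‖u(t,x)‖ ≤ C/√(−t)` (`t < 0`) gives the a.e. bound
`√(−t)‖u‖ ≤ C` on the unit cylinder. [folklore] -/
theorem ae_sqrt_mul_norm_le_of_hasTypeITimeDecay {C : ℝ} (hdec : HasTypeITimeDecay C u) :
    ∀ᵐ z ∂(volume.restrict ssCylinder), Real.sqrt (-z.1) * ‖u z.1 z.2‖ ≤ C := by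
  filter_upwards [ae_restrict_mem isOpen_ssCylinder.measurableSet] with z hz
  have ht : z.1 < 0 := (mem_ssCylinder.1 hz).1.2
  have hpos : 0 < Real.sqrt (-z.1) := Real.sqrt_pos.2 (neg_pos.2 ht)
  calc Real.sqrt (-z.1) * ‖u z.1 z.2‖ ≤ Real.sqrt (-z.1) * (C / Real.sqrt (-z.1)) :=
        mul_le_mul_of_nonneg_left (hdec z.1 ht z.2) hpos.le
    _ = C := mul_div_cancel₀ C hpos.ne'

/-! ## The stub -/

/-- **Stub `stub_axisymmetricFlatCore_unit` (axisymmetric unit-viscosity core of the line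
`scaled-energy-split`).** A classical solution of the unforced Navier–Stokes system with unit
viscosity on `(−∞, 0) × ℝ³` with the Type I rate `‖u(t,x)‖ ≤ C/√(−t)`, axisymmetric
slices and finite Albritton–Barker quantity `𝐈(ℝ³ × ℝ₋) < ∞` is not backward-singular at the
space–time origin: by Seregin–Šverák 2009, Thm. 3.1 (tree theorem
`axisymmetricTypeIExclusion_of_tree`) applied on the unit cylinder to `u` and the
ball-mean-gauged pressure, `u` is essentially bounded on some backward parabolic ball about
the origin. [cite: SereginSverak2009, Thm. 3.1 (= Thm. 1.1)] -/
theorem stub_axisymmetricFlatCore_unit : ∀ (C : ℝ) (u : ℝ → EuclideanSpace ℝ (Fin 3) → EuclideanSpace ℝ (Fin 3)) (p : ℝ → EuclideanSpace ℝ (Fin 3) → ℝ), Literature.Analysis.FluidPDE.IsClassicalNSSolutionOn (Set.Iio 0) 1 0 u p → Literature.Analysis.FluidPDE.HasTypeITimeDecay C u → (∀ t ∈ Set.Iio (0:ℝ), Literature.Analysis.FluidPDE.IsAxisymmetric (u t)) → Literature.Analysis.FluidPDE.typeIBound (Set.Iio (0:ℝ) ×ˢ Set.univ) u p (fun t x =>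 fderiv ℝ (u t) x) < ⊤ → ¬ Literature.Analysis.FluidPDE.IsBackwardSingularPoint u 0 := by
  intro C u p hsol hdec haxi hI hsing
  -- the `C`- and `D`-terms at the admissible ball `Q((0,0), 2)` are finite
  have hsum := abScaledSum_two_lt_top hI
  simp only [abScaledSum, ENNReal.add_lt_top] at hsum
  obtain ⟨⟨⟨-, hC⟩, hD⟩, -⟩ := hsum
  -- Seregin–Šverák on the unit cylinder, with the gauged pressure
  obtain ⟨r, hr, hfin⟩ := axisymmetricTypeIExclusion_of_tree u
    (fun t x => p t x - ⨍ y in ball (0 : EuclideanSpace ℝ (Fin 3)) 2, p t y)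
    (isDistributionalNSSolutionOn_ssCylinder_gauged hsol 2) (lintegral_cube_ssCylinder_lt_top hC)
    (lintegral_gaugedPressure_ssCylinder_lt_top hD) (fun t ht => haxi t ht.2)
    ⟨C, ae_sqrt_mul_norm_le_of_hasTypeITimeDecay hdec⟩
  exact hfin.ne (hsing r hr)

end Summit.NavierStokesRegularity.NavierStokesRegularity.Theorems.FrequencyRigidity.ScaledEnergySplit
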